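import Literature.MathematicalPhysics.QuantumFieldTheory.Balaban1983to89.T4BetaMemorySharp
import Literature.MathematicalPhysics.QuantumFieldTheory.Balaban1983to89.T4OutputRate

/-!
# NE4TransferModel — node U2 (spine estimate NE4) by the RESOLVENT / GENERATING-FUNCTION ROUTE, file 1 of 2: the abstract
# normed ONE-STEP TRANSFER MODEL of Bałaban's renormalization transformation, its one-step LEAVES (hypothesis shapes), and
# row (b) — `T4CouplingMatching.HistLipschitz ∧ FadingMemory` — by the Neumann series of the age-weighted shift
# (cell `pub-balaban`, rung (B)+1 on a fixed torus T⁴; BINDER-OWNERS row NE4, co-owner #3, lineage `b2b-balaban-t4-ne4-p3`,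
# generation 1; file 2 = `Support/NE4TransferResolvent` (rows (a), the triple, `InjectedRate`); companion record
# `t4/skeletons/NE4-t4-ne4-p3.md`)

HONEST FRAMING (T4-DAG PAGE 1).  Rung (B)+1 scoping: existence and uniqueness of the ε → 0 limit of gauge-invariant
expectations on a FIXED finite torus — NOT infinite volume, NOT a mass gap, NOT the Clay problem.  NE4 (node U2: the
η-rate of the full β_k and the K-uniform coupling matching) is a cell NEW ESTIMATE, NOT PRINTED in [Balaban1987RG1] –
[Balaban1989LargeFieldII] and NOT PROVED here.  This module ASSERTS NOTHING about Bałaban's objects: `StepTransferModel` is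
HYPOTHESIS-CARRYING DATA, every `def … : Prop` below is a HYPOTHESIS SHAPE over it (to be discharged by an instantiation,
never cited as a fact), and every `theorem` is kernel-checked bookkeeping (finite sums, one induction) composing the tree's
node-U2 kernels BY NAME.  `FlowStep.BetaPertH`, (B), (B^μ) do not occur; the β⁰-half (AF-0r) of the β sub-cell enters as the
displayed binder `hconv`.  HONEST DEPENDENCY (verbatim): continuum YM on T⁴ ⇐ BetaPertH ∧ nine spine estimates (0/9
proved); BetaPertH ⇐ (D1) ∧ (D4) ∧ CAP+tail; G-an2-4 gates asym, D1 and NE2/3/4.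

THE ROUTE (technique-distinct from the row's P1 «growing-flag Grönwall» and P2 «two-run renewal»).  The coupling history
`(g₀, …, g_k)` reaches Bałaban's new term `E^{(k+1)}` — hence `β_{k+1}` — ONLY through the older stored brackets
`[−β_jA^η + E^{(j)}]`, `j ≤ k`, of (0.23) p. 256 of [I], and these enter the step-k fluctuation integral (2.13) p. 268 ONLY
through the curly bracket of (2.12), which is a DIFFERENCE OF TWO EVALUATIONS of `E_k`, i.e. LINEAR in the family of older
brackets ([II] Lemma 1 (1.33) p. 9; cell GAPS C-b12g6-1, C-b12g8-1).  So one application of the renormalization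
transformation factors as
  `(older brackets) ─W_k(g_k)→ (history activity) ─F_k(g_k,·)→ (new bracket, β¹_{k+1})`,
with `W_k(g)` LINEAR.  The model types exactly this: a linear TRANSFER `W k g : (Fin k → 𝔅) →ₗ[ℝ] 𝔸`, an activity-to-bracket
map `N k g : 𝔸 → 𝔅`, an activity-to-remainder read-out `r k g : 𝔸 → ℝ`, and the stored brackets `B k w` of box histories.
The ONE-STEP LEAVES (each quantifies over ONE step `k`; none has two scale indices, none mentions a second run or `K`;
locators in the declarations' docstrings): `TransferBound C_W ω` (operator-norm form of [II] Lemma 1 (1.36) p. 9 with the one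
surviving age factor `L^jη` per old scale, p. 8 — PRINTED TYPE, modulus = size constant by linearity); `ActivityLipschitz
C_F C_r` (activity → value step of [II] §2 read for a difference — PRINTED TYPE, NOT PRINTED as a statement, G-b12g8-1);
`CouplingLipschitz ℓ′ ℓ` (Lipschitz in the CURRENT coupling — qualitative in print, [I] p. 264, G-t4-U2-2); `Admissible E₀`
((1.18)/(0.29) = (B) for the small-field flow, BY TYPE); `StepScaleShift b b_r ρ` (row (a) only: the one-step η-source =
NE2/NE3 read through the step, BY NAME, NOT PRINTED); scalars `0 < ω`, `ν := ω + C_F·C_W < θ ≤ 1` (the WINDOW — printed TYPE: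
the ε₁-conditions (2.28) p. 18 / «O(1)C₃ε₁ ≤ ½E₀» p. 21 of [II], G-b12g8-2; constant unprinted).
THE ASSEMBLY (kernel): along one history the age-weighted content `N_j = Σ_{i<j} ω^{j−1−i}d_i` of the bracket deviations obeys
the ONE-STEP linear majorant `N_{j+1} ≤ ν·N_j + source_j` — the weighted shift; its Neumann series (the tree's exact resolvent
`T4BetaMemorySharp.state_le` / `renewal_le`, kernel `cz/(1 − ωz)`, resolvent `(1 − ωz)/(1 − νz)`) gives in §3 (this file)
`histLipschitz_of_model` + `fadingMemory_moduli`: `T4CouplingMatching.HistLipschitz (moduli ℓ ℓ′ C_r C_W ν) γ β` with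
`FadingMemory (ℓ + C_r·C_W·ℓ′/ν) ν` — memory rate EXACTLY `ν = ω + C_F·C_W` (sharp for majorants: `T4BetaMemorySharp.impulse_sharp`),
no auxiliary rate; file 2 adds row (a) `RemainderShiftRate`, node U2's triple and the K-uniform `InjectedRate` BY NAME.
WHAT THIS SHOWS ABOUT THE ROW: node U2 AND the β-relevant parts of node U3 (NE5's two-run rate of the brackets; NE9's history
moduli with fading memory) follow from FOUR one-step analytic inputs on ONE application of RT (`TransferBound`,
`ActivityLipschitz`, `CouplingLipschitz`, `StepScaleShift`) + (B)-admissibility + scalars — instance by instance the located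
walls of rows NE5 (`T4InputCauchyRateData`: `InsAffine`/`InsScaleBound`/`DataLipschitz`/`OperatorRate`) and NE9
(`T4HistoryLipschitz*`, `NE9LastCouplingBridge`: `TwoPointKP`, COUPLING TWO-POINT, memory rate `ω + 4·lipbar·B·τ̄` = this file's
`ν`).  No leaf is NE4, NE5 or NE9 in disguise: each quantifies over one step and one history; the multi-step, two-run,
K-uniform content is produced by the kernel.
DICTIONARY (documentation; an instantiation must exhibit these as Lean data): `𝔅` = localized analytic functionals of one
birth scale with the j-UNIFORM norm of (1.18) p. 263, read as functionals of the unit-lattice field through the run's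
background (node U3's carrier convention, `T4OutputRate.Carriers`); `𝔸` = history activities `{V′_k(Y, ·)}_Y` with the
(1.36)-weighted norm; `W k g` = (1.33); `N k g` = (2.13) + [II] §2 + the extraction (0.28); `r k g` = the (1.20)/(1.22)
read-out of β¹_{k+1} ((R), convention (C5) of `t4/T4-EST-U2R.md`); `ω = L^{−1}`, `C_F·C_W ≍ O(1)C₃ε₁/E₀`, so the window
`ν < 1` is of the printed form «O(1)C₃ε₁ ≤ ½E₀» ([II] p. 21; b12-g8 §3(ii)).  None of this is typed or asserted here.
References (TYPES and TEMPLATES only; renders of [I] pp. 256, 258, 264, 268, 298 and [II] pp. 7, 8, 9, 15, 16, 20, 21 read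
as images by this seat): [Balaban1987RG1] CMP 109 (1987) 249–301; [Balaban1988RG2Cluster] CMP 116 (1988) 1–22; [King1986]
CMP 102 (1986) Thm 3.4 (3.9) (shape); [Mastropietro2008] *Non-Perturbative Renormalization* §3.8 (3.70) p. 64, (9.79)–(9.83)
p. 140 (fermionic «short memory property», contraction on the weighted history space — TEMPLATE); [BrydgesSlade2015-V]
J. Stat. Phys. 159 (2015) Thm 1.8.2 (one-step contraction `κ = O(L^{−1})`, analytic in (V, K); |φ|⁴₄ — TEMPLATE).
No `sorry`; axioms ⊆ {propext, Classical.choice, Quot.sound}.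
-/

noncomputable section

open scoped BigOperators
open Finset

namespace Summit.QuantumFields.BalabanUV.T4Continuum.NE4TransferModel

open Literature.MathematicalPhysics.QuantumFieldTheory.Balaban1983to89
open Literature.MathematicalPhysics.QuantumFieldTheory.Balaban1983to89.FlowStep
open Literature.MathematicalPhysics.QuantumFieldTheory.Balaban1983to89.T4CouplingMatching
open Literature.MathematicalPhysics.QuantumFieldTheory.Balaban1983to89.T4BetaMemorySharp (acc acc_zero acc_succ state_le
  renewal_le)
open Literature.MathematicalPhysics.QuantumFieldTheory.Balaban1983to89.T4OutputRate (Window mem_window)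

/-! ## §1 The one-step transfer model (DATA — nothing of Bałaban's construction is built here) -/

/-- **THE ONE-STEP TRANSFER MODEL** of a history-dependent renormalization flow (hypothesis-carrying DATA).
`W k g` — the LINEAR transfer of the family of the `k` older stored brackets into the history activity of step `k` at current
coupling `g` (TYPE: the curly bracket of [Balaban1987RG1] (2.12) p. 268 = [Balaban1988RG2Cluster] (1.33) p. 9, a difference
of two evaluations of `E_k`, hence linear in the older terms); `N k g` — activity ↦ the stored renormalized new bracket
((2.13) p. 268 + [II] §2 + the extraction (0.28) p. 258); `r k g` — activity ↦ the remainder `β¹_{k+1}` ((1.20)/(1.22)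
p. 264 read off the new term); `B k w` — the stored bracket born at step `k` of a run with coupling history
`w = (g₀, …, g_k)` ((0.23) p. 256).  The maps are total functions; the hypothesis shapes of §2 restrict them to the window.
(TYPE locators: [I] (2.12)–(2.13) p. 268, (0.23) p. 256.)  Hypothesis-carrying data; nothing asserted. [folklore] -/
structure StepTransferModel (𝔅 𝔸 : Type*) [NormedAddCommGroup 𝔅] [NormedSpace ℝ 𝔅] [NormedAddCommGroup 𝔸]
    [NormedSpace ℝ 𝔸] where
  /-- linear old-term transfer at step `k`, current coupling `g` -/
  W : (k : ℕ) → ℝ → ((Fin k → 𝔅) →ₗ[ℝ] 𝔸)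
  /-- history activity ↦ stored renormalized new bracket -/
  N : (k : ℕ) → ℝ → 𝔸 → 𝔅
  /-- history activity ↦ remainder `β¹_{k+1}` -/
  r : (k : ℕ) → ℝ → 𝔸 → ℝ
  /-- stored bracket born at step `k` from the history `(g₀, …, g_k)` -/
  B : (k : ℕ) → (Fin (k + 1) → ℝ) → 𝔅

variable {𝔅 𝔸 : Type*} [NormedAddCommGroup 𝔅] [NormedSpace ℝ 𝔅] [NormedAddCommGroup 𝔸] [NormedSpace ℝ 𝔸]

namespace StepTransferModel

variable (M : StepTransferModel 𝔅 𝔸)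

/-- The family of the `k` OLDER stored brackets of a run with coupling sequence `g`, seen at step `k`:
`j ↦ B j (g₀, …, g_j)`, `j < k`. [folklore] -/
def older (k : ℕ) (g : ℕ → ℝ) : Fin k → 𝔅 := fun j => M.B j (prefixOf g j)

/-- Unfolding of `older`. [folklore] -/
@[simp] theorem older_apply (k : ℕ) (g : ℕ → ℝ) (j : Fin k) : M.older k g j = M.B j (prefixOf g j) := rfl

/-- The history activity of step `k` along the coupling sequence `g`: the transfer of the older brackets at the current
coupling `g k`. [folklore] -/
def act (k : ℕ) (g : ℕ → ℝ) : 𝔸 := M.W k (g k) (M.older k g)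

/-! ## §2 The leaves (hypothesis shapes over the model; each quantifies over ONE step) -/

/-- STRUCTURE (identification, no inequality): the stored brackets of windowed runs are the ORBIT of the one-step maps —
`B k (g₀,…,g_k) = N k g_k (W k g_k (older brackets))`: older couplings enter step `k` ONLY through the older brackets
([I] (2.12)–(2.13) p. 268 with (0.23) p. 256; cell census C-b12g6-1).  Hypothesis shape; asserted by nobody. [folklore] -/
def Represents (γ : ℝ) : Prop :=
  ∀ k (g : ℕ → ℝ), g ∈ Window γ → M.B k (prefixOf g k) = M.N k (g k) (M.act k g)

/-- STRUCTURE (identification): the remainder `β¹_{k+1}` of the printed one-loop split (`B12Beta.OneLoopSplit`,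
[I] (2.12)–(2.14) p. 268) of a history-dependent family `β` is READ OFF the step-`k` activity: `S.β1 k (g₀,…,g_k) =
r k g_k (W k g_k (older brackets))` ((1.20)/(1.22) p. 264: β_{k+1} is a linear functional of the new term; convention (C5)
of `t4/T4-EST-U2R.md`).  Hypothesis shape; asserted by nobody. [folklore] -/
def ReadsRemainder {β : HBeta} (S : B12Beta.OneLoopSplit β) (γ : ℝ) : Prop :=
  ∀ k (g : ℕ → ℝ), g ∈ Window γ → S.β1 k (prefixOf g k) = M.r k (g k) (M.act k g)

/-- LEAF (one step; PRINTED TYPE): the AGE-WEIGHTED TRANSFER BOUND — the operator-norm form of [II] Lemma 1 (1.36) p. 9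
with the one surviving age factor per old scale of [II] p. 8 («we use the factor (L^jη)⁵ in (1.24). This yields (6L)⁴L^jη,
and the sum over j is bounded by 2(6L)⁴»; p. 9 «The first term under the exponential gives also the factor L^jη, which
controls the sum over j»): `‖W k g E‖ ≤ C_W Σ_{j<k} ω^{k−1−j}‖E_j‖` for every family `E` (linearity: bound on the unit
ball = bound on differences, C-b12g8-1).  `ω` models `L^{−1}`; the youngest old bracket (`j = k − 1`) is undamped.  NOT
PRINTED as a statement about differences (TYPE locator: [II] Lemma 1 (1.33)–(1.36) p. 9); hypothesis shape, asserted by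
nobody. [folklore] -/
def TransferBound (C_W ω γ : ℝ) : Prop :=
  ∀ k (c : ℝ) (E : Fin k → 𝔅), 0 < c → c ≤ γ →
    ‖M.W k c E‖ ≤ C_W * ∑ j : Fin k, ω ^ (k - 1 - (j : ℕ)) * ‖E j‖

/-- LEAF (one step; PRINTED TYPE, NOT PRINTED as a statement — cell GAPS G-b12g8-1): ACTIVITY → VALUE LIPSCHITZ at admissible
old data — the stored new bracket (constant `C_F`) and the β¹ read-out (constant `C_r`) are Lipschitz in the history
activity: the device of [II] (2.14) p. 15 / (2.18) p. 16 (the activities enter through `exp[Σ τ(Y)V_k(Y,B)]` with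
complexified multipliers of radius = inverse activity level × α₄), Lemma 3 (2.38) p. 20 and (2.41) p. 21, read for a
difference by one Cauchy estimate in an interpolation parameter (tree engine for the published generic form:
`Dimock2015.AnalyticLipschitz.norm_sub_le_of_margin`; Kotecký–Preiss form: `T4ActivityLipschitz`).  TYPE locator: [II]
(2.14) p. 15, Lemma 3 (2.38) p. 20.  Hypothesis shape; asserted by nobody. [folklore] -/
def ActivityLipschitz (C_F C_r E₀ γ : ℝ) : Prop :=
  ∀ k (c : ℝ) (E E' : Fin k → 𝔅), 0 < c → c ≤ γ → (∀ j, ‖E j‖ ≤ E₀) → (∀ j, ‖E' j‖ ≤ E₀) →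
    ‖M.N k c (M.W k c E) - M.N k c (M.W k c E')‖ ≤ C_F * ‖M.W k c E - M.W k c E'‖ ∧
    |M.r k c (M.W k c E) - M.r k c (M.W k c E')| ≤ C_r * ‖M.W k c E - M.W k c E'‖

/-- LEAF (one step; qualitative in print — cell GAPS G-t4-U2-2): LIPSCHITZ DEPENDENCE ON THE CURRENT COUPLING at fixed
admissible old data, of the stored new bracket (`ℓ′`) and of β¹ (`ℓ`) ([I] p. 264 «It is a smooth function defined on the
interval [0, γ], (or analytic), uniformly bounded on this interval together with all derivatives» — of the LAST coupling,
no modulus printed; p. 263 the same clause for `E^{(j)}`).  Hypothesis shape; asserted by nobody. [folklore] -/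
def CouplingLipschitz (ℓ' ℓ E₀ γ : ℝ) : Prop :=
  ∀ k (c c' : ℝ) (E : Fin k → 𝔅), 0 < c → c ≤ γ → 0 < c' → c' ≤ γ → (∀ j, ‖E j‖ ≤ E₀) →
    ‖M.N k c (M.W k c E) - M.N k c' (M.W k c' E)‖ ≤ ℓ' * |c - c'| ∧
    |M.r k c (M.W k c E) - M.r k c' (M.W k c' E)| ≤ ℓ * |c - c'|

/-- LEAF (one run; PRINTED as the inductive bound of Theorem 3 p. 264 of [I] = (B) of the series for the small-field flow,
BY TYPE): ADMISSIBILITY — every stored bracket of a windowed run has norm `≤ E₀` in the j-uniform (1.18) currency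
((1.18) p. 263; (0.29) p. 258 for the renormalized brackets; TYPE locator [I] Thm 3 p. 264).  A hypothesis SHAPE here,
never asserted. [folklore] -/
def Admissible (E₀ γ : ℝ) : Prop :=
  ∀ k (g : ℕ → ℝ), g ∈ Window γ → ‖M.B k (prefixOf g k)‖ ≤ E₀

/-- LEAF (one step; NOT PRINTED — other spine rows BY NAME): the ONE-STEP SCALE SHIFT AT FIXED OLD DATA.  The step one level
deeper (index `k + 1`: one more ultraviolet scale below, i.e. η/L), fed the SAME `k` old brackets and a SILENT extra oldest
slot, differs from the step at depth `k` by `≤ bρ^k` (stored bracket) and `≤ b_rρ^k` (β¹): the η-dependence of the one-step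
DATA — covariances/propagators `C^{(k)}`, `G_k`, `H₁` (node U1a, cell estimate NE2, `T4EtaRate`), minimisers `U_{k+1}(V)`
(node U1b, NE3, `T4EtaRateMin`), the O(η²) Wilson vertices — read through the step's Lipschitz dependence on its data
(`T4InputCauchyRateData.OperatorRate`/`OpFibreEnvelope` of row NE5).  Print has only the UNIFORMITY in η ([I] Thm 1
p. 259).  Hypothesis shape; asserted by nobody. [folklore] -/
def StepScaleShift (b b_r ρ E₀ γ : ℝ) : Prop :=
  ∀ k (c : ℝ) (E : Fin k → 𝔅), 0 < c → c ≤ γ → (∀ j, ‖E j‖ ≤ E₀) →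
    ‖M.N (k + 1) c (M.W (k + 1) c (Matrix.vecCons 0 E)) - M.N k c (M.W k c E)‖ ≤ b * ρ ^ k ∧
    |M.r (k + 1) c (M.W (k + 1) c (Matrix.vecCons 0 E)) - M.r k c (M.W k c E)| ≤ b_r * ρ ^ k

end StepTransferModel

/-! ## §2b Elementary tools: extension of a box history to a windowed sequence; geometric content -/

/-- Extension of a box history `w = (g₀,…,g_k)` to an infinite sequence (constant `g_k` beyond `k`). [folklore] -/
def extend {k : ℕ} (w : Fin (k + 1) → ℝ) : ℕ → ℝ :=
  fun i => if h : i ≤ k then w ⟨i, Nat.lt_succ_of_le h⟩ else w (Fin.last k)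

/-- The extension restricts back to the history. [folklore] -/
theorem prefixOf_extend {k : ℕ} (w : Fin (k + 1) → ℝ) : prefixOf (extend w) k = w := by
  funext i
  have hi : (i : ℕ) ≤ k := Nat.le_of_lt_succ i.isLt
  simp [prefixOf, extend, hi]

/-- The extension of a box history is a windowed sequence. [folklore] -/
theorem extend_mem_window {γ : ℝ} {k : ℕ} {w : Fin (k + 1) → ℝ} (hw : w ∈ Box γ k) : extend w ∈ Window γ := by
  intro i
  by_cases hi : i ≤ k
  · simpa [extend, hi] using (mem_box.mp hw) ⟨i, Nat.lt_succ_of_le hi⟩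
  · simpa [extend, hi] using (mem_box.mp hw) (Fin.last k)

/-- The shifted sequence of a windowed sequence is windowed. [folklore] -/
theorem shift_mem_window {γ : ℝ} {g : ℕ → ℝ} (hg : g ∈ Window γ) : (fun n => g (n + 1)) ∈ Window γ :=
  fun i => hg (i + 1)

/-- Prefixes of a windowed sequence lie in the boxes. [folklore] -/
theorem prefixOf_mem_box_of_window {γ : ℝ} {g : ℕ → ℝ} (hg : g ∈ Window γ) (k : ℕ) : prefixOf g k ∈ Box γ k :=
  mem_box.mpr fun i => hg i

/-- EXACT GEOMETRIC CONTENT: `(θ − ν)·Σ_{m<n} ν^{n−1−m}θ^m = θ^n − ν^n`. [folklore] -/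
theorem acc_pow_mul (ν θ : ℝ) : ∀ n, (θ - ν) * acc ν (fun m => θ ^ m) n = θ ^ n - ν ^ n := by
  intro n
  induction n with
  | zero => simp [acc_zero]
  | succ n ih =>
    rw [acc_succ]
    have : (θ - ν) * (ν * acc ν (fun m => θ ^ m) n + θ ^ n)
        = ν * ((θ - ν) * acc ν (fun m => θ ^ m) n) + (θ - ν) * θ ^ n := by ring
    rw [this, ih]; ring

/-- Geometric content against a FASTER rate: `0 ≤ ν < θ` ⇒ `Σ_{m<n} ν^{n−1−m}θ^m ≤ θ^n/(θ − ν)`. [folklore] -/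
theorem acc_pow_le {ν θ : ℝ} (hν : 0 ≤ ν) (hνθ : ν < θ) (n : ℕ) :
    acc ν (fun m => θ ^ m) n ≤ θ ^ n / (θ - ν) := by
  have hpos : 0 < θ - ν := sub_pos.mpr hνθ
  rw [le_div_iff₀ hpos, mul_comm, acc_pow_mul]
  linarith [pow_nonneg hν n]

/-- Monotonicity of the accumulated content in the (nonnegative) data. [folklore] -/
theorem acc_le_acc {ν : ℝ} (hν : 0 ≤ ν) {b f : ℕ → ℝ} (h : ∀ m, b m ≤ f m) (n : ℕ) : acc ν b n ≤ acc ν f n := by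
  unfold acc
  exact Finset.sum_le_sum fun m _ => mul_le_mul_of_nonneg_left (h m) (pow_nonneg hν _)

/-- Scaling of the accumulated content. [folklore] -/
theorem acc_const_mul (ν a : ℝ) (f : ℕ → ℝ) (n : ℕ) : acc ν (fun m => a * f m) n = a * acc ν f n := by
  unfold acc
  rw [Finset.mul_sum]
  exact Finset.sum_congr rfl fun m _ => by ring

/-- The transfer weights of §2 are the accumulated-content weights: `Σ_{j : Fin k} ω^{k−1−j} x_j = acc ω x k`. [folklore] -/
theorem sum_fin_weight_eq_acc (ω : ℝ) (x : ℕ → ℝ) (k : ℕ) :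
    ∑ j : Fin k, ω ^ (k - 1 - (j : ℕ)) * x j = acc ω x k := by
  unfold acc
  exact Fin.sum_univ_eq_sum_range (fun j => ω ^ (k - 1 - j) * x j) k

/-! ## §3 Row (b): history moduli with fading memory from the one-step leaves (the Neumann series of the weighted shift) -/

namespace StepTransferModel

variable {M : StepTransferModel 𝔅 𝔸}

/-- THE ONE-STEP DEVIATION INEQUALITY (kernel).  Along two windowed coupling sequences `p, q`, the deviation
`d_j = ‖B j (p₀..p_j) − B j (q₀..q_j)‖` of the stored brackets obeys
`d_j ≤ ℓ′|p_j − q_j| + C_F·C_W·Σ_{i<j} ω^{j−1−i} d_i` — coupling modulus + activity Lipschitz ∘ LINEAR transfer of the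
older deviations. [folklore] -/
theorem deviation_step {γ C_W ω C_F C_r ℓ' ℓ E₀ : ℝ} (hRep : M.Represents γ) (hT : M.TransferBound C_W ω γ)
    (hA : M.ActivityLipschitz C_F C_r E₀ γ) (hC : M.CouplingLipschitz ℓ' ℓ E₀ γ) (hAdm : M.Admissible E₀ γ)
    (hCF : 0 ≤ C_F) {p q : ℕ → ℝ} (hp : p ∈ Window γ) (hq : q ∈ Window γ) (j : ℕ) :
    ‖M.B j (prefixOf p j) - M.B j (prefixOf q j)‖ ≤
      ℓ' * |p j - q j| + C_F * C_W * acc ω (fun i => ‖M.B i (prefixOf p i) - M.B i (prefixOf q i)‖) j := by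
  have hEp : ∀ i : Fin j, ‖M.older j p i‖ ≤ E₀ := fun i => hAdm i p hp
  have hEq : ∀ i : Fin j, ‖M.older j q i‖ ≤ E₀ := fun i => hAdm i q hq
  rw [hRep j p hp, hRep j q hq]
  -- split: same coupling p j, old data p vs q; then same old data q, coupling p j vs q j
  have h1 := (hA j (p j) (M.older j p) (M.older j q) (hp j).1 (hp j).2 hEp hEq).1
  have h2 := (hC j (p j) (q j) (M.older j q) (hp j).1 (hp j).2 (hq j).1 (hq j).2 hEq).1
  have hlin : M.W j (p j) (M.older j p) - M.W j (p j) (M.older j q) = M.W j (p j) (M.older j p - M.older j q) := by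
    rw [map_sub]
  have h3 := hT j (p j) (M.older j p - M.older j q) (hp j).1 (hp j).2
  have h3' : ‖M.W j (p j) (M.older j p) - M.W j (p j) (M.older j q)‖ ≤
      C_W * acc ω (fun i => ‖M.B i (prefixOf p i) - M.B i (prefixOf q i)‖) j := by
    rw [hlin]
    refine h3.trans (le_of_eq ?_)
    rw [← sum_fin_weight_eq_acc]
    simp [older]
  calc ‖M.N j (p j) (M.act j p) - M.N j (q j) (M.act j q)‖
      ≤ ‖M.N j (p j) (M.act j p) - M.N j (p j) (M.W j (p j) (M.older j q))‖
        + ‖M.N j (p j) (M.W j (p j) (M.older j q)) - M.N j (q j) (M.act j q)‖ := norm_sub_le_norm_sub_add_norm_sub _ _ _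
    _ ≤ C_F * ‖M.W j (p j) (M.older j p) - M.W j (p j) (M.older j q)‖ + ℓ' * |p j - q j| := add_le_add h1 h2
    _ ≤ C_F * (C_W * acc ω (fun i => ‖M.B i (prefixOf p i) - M.B i (prefixOf q i)‖) j) + ℓ' * |p j - q j| :=
        add_le_add (mul_le_mul_of_nonneg_left h3' hCF) le_rfl
    _ = _ := by ring

/-- THE NEUMANN SERIES OF THE WEIGHTED SHIFT (kernel).  The age-weighted content of the deviations,
`N_j = Σ_{i<j} ω^{j−1−i} d_i`, obeys `N_{j+1} = ω·N_j + d_j ≤ (ω + C_F·C_W)·N_j + ℓ′|p_j − q_j|`, hence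
`N_j ≤ ℓ′·Σ_{i<j} ν^{j−1−i}|p_i − q_i|` with `ν = ω + C_F·C_W` (the tree's exact resolvent `T4BetaMemorySharp.state_le`).
[folklore] -/
theorem weightedContent_le {γ C_W ω C_F C_r ℓ' ℓ E₀ : ℝ} (hRep : M.Represents γ) (hT : M.TransferBound C_W ω γ)
    (hA : M.ActivityLipschitz C_F C_r E₀ γ) (hC : M.CouplingLipschitz ℓ' ℓ E₀ γ) (hAdm : M.Admissible E₀ γ)
    (hω : 0 ≤ ω) (hCF : 0 ≤ C_F) (hCW : 0 ≤ C_W) {p q : ℕ → ℝ} (hp : p ∈ Window γ) (hq : q ∈ Window γ) (j : ℕ) :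
    acc ω (fun i => ‖M.B i (prefixOf p i) - M.B i (prefixOf q i)‖) j ≤
      acc (ω + C_F * C_W) (fun i => ℓ' * |p i - q i|) j :=
  state_le (s := fun n => acc ω (fun i => ‖M.B i (prefixOf p i) - M.B i (prefixOf q i)‖) n)
    (b := fun i => ‖M.B i (prefixOf p i) - M.B i (prefixOf q i)‖) hω (mul_nonneg hCF hCW)
    (by simp [acc_zero]) (fun n => (acc_succ ω _ n).le)
    (fun n => deviation_step hRep hT hA hC hAdm hCF hp hq n) j

end StepTransferModel

/-- THE HISTORY MODULI produced by the route: `Λ k k = ℓ` (direct, last coupling), `Λ k i = C_r·C_W·ℓ′·ν^{k−1−i}` for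
`i < k` (read-out × transfer × Neumann series), `0` for `i > k`. [folklore] -/
def moduli (ℓ ℓ' C_r C_W ν : ℝ) (k i : ℕ) : ℝ :=
  if i = k then ℓ else if i < k then C_r * C_W * ℓ' * ν ^ (k - 1 - i) else 0

/-- The moduli have FADING MEMORY at the rate `ν` (for `ν > 0`): `T4CouplingMatching.FadingMemory (ℓ + C_r·C_W·ℓ′/ν) ν`.
[folklore] -/
theorem fadingMemory_moduli {ℓ ℓ' C_r C_W ν : ℝ} (hℓ : 0 ≤ ℓ) (hℓ' : 0 ≤ ℓ') (hCr : 0 ≤ C_r) (hCW : 0 ≤ C_W)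
    (hν : 0 < ν) : T4CouplingMatching.FadingMemory (ℓ + C_r * C_W * ℓ' / ν) ν (moduli ℓ ℓ' C_r C_W ν) := by
  intro k i hik
  have hP : 0 ≤ C_r * C_W * ℓ' := by positivity
  have hQ : 0 ≤ C_r * C_W * ℓ' / ν := div_nonneg hP hν.le
  by_cases h : i = k
  · subst h
    refine ⟨by simp [moduli, hℓ], ?_⟩
    simp only [moduli, if_true, Nat.sub_self, pow_zero, mul_one]
    linarith
  · have hlt : i < k := lt_of_le_of_ne hik h
    simp only [moduli, h, if_false, hlt, if_true]
    refine ⟨mul_nonneg hP (pow_nonneg hν.le _), ?_⟩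
    have e : ν ^ (k - i) = ν * ν ^ (k - 1 - i) := by
      rw [← pow_succ']; congr 1; omega
    have h1 : C_r * C_W * ℓ' * ν ^ (k - 1 - i) = (C_r * C_W * ℓ' / ν) * ν ^ (k - i) := by
      rw [e]; field_simp
    rw [h1]
    exact mul_le_mul_of_nonneg_right (by linarith) (pow_nonneg hν.le _)

/-- The moduli sum splits into the direct term and the accumulated content. [folklore] -/
theorem sum_moduli_eq (ℓ ℓ' C_r C_W ν : ℝ) (k : ℕ) (δ : ℕ → ℝ) :
    ∑ i : Fin (k + 1), moduli ℓ ℓ' C_r C_W ν k i * δ i = ℓ * δ k + C_r * C_W * acc ν (fun i => ℓ' * δ i) k := by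
  rw [Fin.sum_univ_castSucc]
  have hlast : moduli ℓ ℓ' C_r C_W ν k (Fin.last k) * δ (Fin.last k) = ℓ * δ k := by
    simp [moduli]
  have hinit : ∑ i : Fin k, moduli ℓ ℓ' C_r C_W ν k (Fin.castSucc i) * δ (Fin.castSucc i)
      = C_r * C_W * acc ν (fun i => ℓ' * δ i) k := by
    unfold acc
    rw [← Fin.sum_univ_eq_sum_range (fun i => ν ^ (k - 1 - i) * (ℓ' * δ i)) k, Finset.mul_sum]
    refine Finset.sum_congr rfl fun i _ => ?_
    have hne : (i : ℕ) ≠ k := Nat.ne_of_lt i.isLt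
    simp only [Fin.val_castSucc, moduli, hne, if_false, i.isLt, if_true]
    ring
  rw [hlast, hinit]; ring

/-- **ROW (b) FROM THE ONE-STEP LEAVES (kernel): `T4CouplingMatching.HistLipschitz`** for the full history-dependent family
`β` (the β⁰-half of the printed one-loop split is coupling-free and cancels), with the moduli `moduli ℓ ℓ′ C_r C_W ν`,
`ν = ω + C_F·C_W`.  Hypotheses: the two identifications, the four one-step leaves `TransferBound`, `ActivityLipschitz`,
`CouplingLipschitz`, `Admissible`, and signs.  The memory rate `ν` carries NO auxiliary rate and NO smallness.
(Print on the history dependence: [I] p. 298 only.) [folklore] -/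
theorem histLipschitz_of_model {β : HBeta} (S : B12Beta.OneLoopSplit β) (M : StepTransferModel 𝔅 𝔸)
    {γ C_W ω C_F C_r ℓ' ℓ E₀ : ℝ} (hRep : M.Represents γ) (hRead : M.ReadsRemainder S γ)
    (hT : M.TransferBound C_W ω γ) (hA : M.ActivityLipschitz C_F C_r E₀ γ) (hC : M.CouplingLipschitz ℓ' ℓ E₀ γ)
    (hAdm : M.Admissible E₀ γ) (hω : 0 ≤ ω) (hCF : 0 ≤ C_F) (hCW : 0 ≤ C_W) (hCr : 0 ≤ C_r) :
    HistLipschitz (moduli ℓ ℓ' C_r C_W (ω + C_F * C_W)) γ β := by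
  intro k p q hp hq
  -- extend the two box histories to windowed sequences
  set gp := extend p
  set gq := extend q
  have hwp : gp ∈ Window γ := extend_mem_window hp
  have hwq : gq ∈ Window γ := extend_mem_window hq
  have ep : p = prefixOf gp k := (prefixOf_extend p).symm
  have eq' : q = prefixOf gq k := (prefixOf_extend q).symm
  have hEp : ∀ i : Fin k, ‖M.older k gp i‖ ≤ E₀ := fun i => hAdm i gp hwp
  have hEq : ∀ i : Fin k, ‖M.older k gq i‖ ≤ E₀ := fun i => hAdm i gq hwq
  -- β-difference = β¹-difference
  have esplit : β k p - β k q = S.β1 k p - S.β1 k q := by rw [S.split k p, S.split k q]; ring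
  rw [esplit, ep, eq', hRead k gp hwp, hRead k gq hwq]
  -- read-out: activity Lipschitz at the same coupling + coupling modulus at the same old data
  have h1 := (hA k (gp k) (M.older k gp) (M.older k gq) (hwp k).1 (hwp k).2 hEp hEq).2
  have h2 := (hC k (gp k) (gq k) (M.older k gq) (hwp k).1 (hwp k).2 (hwq k).1 (hwq k).2 hEq).2
  have hlin : M.W k (gp k) (M.older k gp) - M.W k (gp k) (M.older k gq) = M.W k (gp k) (M.older k gp - M.older k gq) := by
    rw [map_sub]
  have h3 : ‖M.W k (gp k) (M.older k gp) - M.W k (gp k) (M.older k gq)‖ ≤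
      C_W * acc ω (fun i => ‖M.B i (prefixOf gp i) - M.B i (prefixOf gq i)‖) k := by
    rw [hlin]
    refine (hT k (gp k) _ (hwp k).1 (hwp k).2).trans (le_of_eq ?_)
    rw [← sum_fin_weight_eq_acc]
    simp [StepTransferModel.older]
  have h4 := M.weightedContent_le hRep hT hA hC hAdm hω hCF hCW hwp hwq k
  have hmain : |M.r k (gp k) (M.act k gp) - M.r k (gq k) (M.act k gq)| ≤
      ℓ * |gp k - gq k| + C_r * C_W * acc (ω + C_F * C_W) (fun i => ℓ' * |gp i - gq i|) k := by
    calc |M.r k (gp k) (M.act k gp) - M.r k (gq k) (M.act k gq)|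
        ≤ |M.r k (gp k) (M.act k gp) - M.r k (gp k) (M.W k (gp k) (M.older k gq))|
          + |M.r k (gp k) (M.W k (gp k) (M.older k gq)) - M.r k (gq k) (M.act k gq)| := abs_sub_le _ _ _
      _ ≤ C_r * ‖M.W k (gp k) (M.older k gp) - M.W k (gp k) (M.older k gq)‖ + ℓ * |gp k - gq k| := add_le_add h1 h2
      _ ≤ C_r * (C_W * acc (ω + C_F * C_W) (fun i => ℓ' * |gp i - gq i|) k) + ℓ * |gp k - gq k| :=
          add_le_add (mul_le_mul_of_nonneg_left (h3.trans (mul_le_mul_of_nonneg_left h4 hCW)) hCr) le_rfl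
      _ = _ := by ring
  -- rewrite the target sum
  have hsum : ∑ i : Fin (k + 1), moduli ℓ ℓ' C_r C_W (ω + C_F * C_W) k i * |prefixOf gp k i - prefixOf gq k i|
      = ℓ * |gp k - gq k| + C_r * C_W * acc (ω + C_F * C_W) (fun i => ℓ' * |gp i - gq i|) k := by
    have := sum_moduli_eq ℓ ℓ' C_r C_W (ω + C_F * C_W) k (fun i => |gp i - gq i|)
    simpa [prefixOf] using this
  rw [hsum]
  exact hmain

end Summit.QuantumFields.BalabanUV.T4Continuum.NE4TransferModel
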